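import Literature.Analysis.FluidPDE.AxisymNoSwirlEnstrophyIneq
import HarnessLib

/-!
# The enstrophy inequality for axisymmetric flows without swirl WITH A FORCE (whole space)

Analysis/FluidPDE proof file (all results proved, no definitions, no named facts). FORCED twin of
`AxisymNoSwirlEnstrophyIneq` (Lemarié-Rieusset 2016, Thm. 10.4, proof p. 289, printed with
`f = 0`): for a classical solution of the Navier–Stokes system WITH A FORCE `f` on
`[0, T] × ℝ³`, axisymmetric without swirl at all times,
`∂ₜ‖ω‖₂² = −2ν‖∇⊗ω‖₂² + 2∫ u_r ω_θ²/r dx + 2∫ ⟨ω, curl f⟩ dx`;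
the stretching density obeys `|u_r ω_θ²/r| ≤ |u| |ω_θ/r| |ω_θ|`
(`AxisymVorticityAlgebra.abs_inner_stretch_le_of_eq_smul_rotGen`) and the work of the force's
vorticity obeys `|⟨ω, curl f⟩| ≤ |ω| |curl f|`. The localisation with the squared ball cutoff
`χ_R` (Tao's weighted enstrophy identity `TaoEnstrophyIdentity.integral_enstrophyProduction_mul_weight`,
which carries the force term), the `O(R⁻¹)` cutoff errors and the limit `R → ∞` are exactly as
in the unforced file; only the majorant changes — it now majorises stretching PLUS work:

* `enstrophyProduction_sqBallCutoff_le_forced` — at a fixed time,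
  `∫⟨ω,∂ₜω⟩χ_R ≤ −ν∫|Dω|²_Fχ_R + C/R + Φ` whenever `∫ |q| |ω| |u| + ∫ |ω| |curl f| ≤ Φ`
  (`q = ω_θ/r`);
* `enstrophy_sqBallCutoff_integral_le_forced` — integrated in time;
* `enstrophy_integral_le_forced` — **the whole-space forced enstrophy inequality**
  `‖ω(t)‖₂² + 2ν∫₀ᵗ‖∇ω‖₂² ≤ ‖ω(0)‖₂² + 2∫₀ᵗ Φ` for any `L¹` majorant `Φ` of the stretching-plus-work
  integrals.

No symmetry of the force is needed here (only in Ladyzhenskaya's weighted estimate,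
`LadyzhenskayaWeightedEstimateForced`). The data-dependent choice of `Φ` and Grönwall's lemma
are carried out in `AxisymmetricNoSwirlAprioriForced`. WHAT THIS IS NOT: not a statement about
Navier–Stokes blow-up — an energy-type identity with its error bookkeeping.

## Mathlib / tree search

`lean search 'enstrophy_integral_le_forced'`: nothing before this file. Used: the static-weight
lemmas `localisedEnstrophy_sub_eq_integral`, `continuousOn_integral_enstrophyProduction_static`,
`continuousOn_localisedEnstrophyDissipation_static`, `tendsto_integral_mul_sqBallCutoff`
(all equation-free, `AxisymNoSwirlEnstrophyIneq` / `LadyzhenskayaWeightedEstimate`),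
`integral_enstrophyProduction_mul_weight` (`TaoEnstrophyIdentity`), the `AxisymWeights` API.

## References

* P. G. Lemarié-Rieusset, *The Navier–Stokes Problem in the 21st Century*, CRC Press (2016),
  §10.3, proof of Thm. 10.4, pp. 288–289. [LemarieRieusset2016]
* O. A. Ladyzhenskaya, Zap. Naučn. Sem. LOMI 7 (1968) 155–177 (forced axisymmetric problem).
-/

noncomputable section

open Set Function Filter MeasureTheory Metric Topology intervalIntegral
open scoped RealInnerProductSpace ENNReal NNReal Topology Interval

namespace Literature.Analysis.FluidPDE

/-! ### The slice inequality against the ball cutoff, with force -/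

section Slice

variable {T ν : ℝ} {f u : ℝ → EuclideanSpace ℝ (Fin 3) → EuclideanSpace ℝ (Fin 3)}
  {p : ℝ → EuclideanSpace ℝ (Fin 3) → ℝ}

/-- **The enstrophy production against the ball cutoff, axisymmetric flow without swirl, WITH A
FORCE** (Lemarié-Rieusset 2016, p. 289: `∂ₜ‖ω‖₂² = −2ν‖ω‖²_{Ḣ¹} + 2∫ u_r ω_θ²/r dx`, plus the
work `2∫⟨ω, curl f⟩` of the force, here localised with `χ_R` on the whole space). For a classical
solution with force `f` on `[0, T] × ℝ³` whose slice `u(t)` is axisymmetric without swirl, with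
`|u(t)| ≤ V`, `∫|ω(t)|² ≤ Y⋆`, `∫|Dω(t)|²_F ≤ D⋆`, and `∫ |q| |ω| |u| + ∫ |ω| |curl f(t)| ≤ Φ`
(`q = ω_θ/r`):
`∫⟨ω,∂ₜω⟩χ_R ≤ −ν ∫|Dω|²_F χ_R + (6√2νD(Y⋆ + D⋆) + 2√2DVY⋆)/R + Φ`.
[cite: LemarieRieusset2016, §10.3 p. 289] -/
theorem enstrophyProduction_sqBallCutoff_le_forced (hT : 0 < T) (hν : 0 ≤ ν)
    (hsol : IsClassicalNSSolutionOn (Icc 0 T) ν f u p) {t : ℝ} (ht : t ∈ Icc 0 T)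
    (hax : IsAxisymmetric (u t)) (hsw : HasNoSwirl (u t))
    {D : ℝ} (hD : ∀ s, |deriv Real.smoothTransition s| ≤ D) {R : ℝ} (hR : 1 ≤ R)
    {V Ystar Dstar Φ : ℝ} (hV : ∀ x, ‖u t x‖ ≤ V)
    (hY : Integrable fun x => ‖curl (u t) x‖ ^ 2) (hYstar : ∫ x, ‖curl (u t) x‖ ^ 2 ≤ Ystar)
    (hDi : Integrable fun x => frobeniusNormSq (fderiv ℝ (curl (u t)) x))
    (hDstar : ∫ x, frobeniusNormSq (fderiv ℝ (curl (u t)) x) ≤ Dstar)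
    (hSi : Integrable fun x =>
      |hadamardQuotFst (fun y => curl (u t) y 1) x| * ‖curl (u t) x‖ * ‖u t x‖)
    (hWi : Integrable fun x => ‖curl (u t) x‖ * ‖curl (f t) x‖)
    (hΦ : (∫ x, |hadamardQuotFst (fun y => curl (u t) y 1) x| * ‖curl (u t) x‖ * ‖u t x‖) +
      (∫ x, ‖curl (u t) x‖ * ‖curl (f t) x‖) ≤ Φ) :
    ∫ x, enstrophyProduction T u t x * Real.smoothTransition (2 - ‖x‖ ^ 2 / R ^ 2) ^ 2 ≤
      -(ν * ∫ x, frobeniusNormSq (fderiv ℝ (curl (u t)) x) *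
          Real.smoothTransition (2 - ‖x‖ ^ 2 / R ^ 2) ^ 2) +
        (6 * Real.sqrt 2 * ν * D * (Ystar + Dstar) + 2 * Real.sqrt 2 * D * V * Ystar) / R + Φ := by
  set q : EuclideanSpace ℝ (Fin 3) → ℝ := hadamardQuotFst (fun y => curl (u t) y 1) with hqdef
  set χ : EuclideanSpace ℝ (Fin 3) → ℝ := fun y =>
    Real.smoothTransition (2 - ‖y‖ ^ 2 / R ^ 2) ^ 2 with hχdef
  have hU : UniqueDiffOn ℝ (Icc 0 T) := uniqueDiffOn_Icc hT
  have hR0 : 0 < R := by linarith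
  have hD0 : 0 ≤ D := (abs_nonneg _).trans (hD 0)
  have hV0 : 0 ≤ V := (norm_nonneg _).trans (hV 0)
  have hY0 : 0 ≤ Ystar := (integral_nonneg fun x => sq_nonneg _).trans hYstar
  have hDs0 : 0 ≤ Dstar := (integral_nonneg fun x => frobeniusNormSq_nonneg _).trans hDstar
  -- regularity of the slice
  have hu3 : ContDiff ℝ 3 (u t) := (hsol.contDiff_velocity ht).of_le (by norm_cast)
  have hu2 : ContDiff ℝ 2 (u t) := hu3.of_le (by norm_cast)
  have hu1 : ContDiff ℝ 1 (u t) := hu3.of_le (by norm_cast)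
  have hω : curl (u t) = fun y => q y • rotGen y :=
    funext fun y => curl_eq_hadamardQuotFst_smul_rotGen hax hsw hu2 y
  have hax' : ∀ x, fderiv ℝ (u t) x (rotGen x) = rotGen (u t x) := fun x =>
    hax.fderiv_rotGen ((hu1.differentiable one_ne_zero) x)
  have hω1 : ContDiff ℝ 1 (curl (u t)) := contDiff_curl (n := 1) (by exact_mod_cast hu2)
  have hωc : Continuous (curl (u t)) := hω1.continuous
  have hDωc : Continuous (fderiv ℝ (curl (u t))) := hω1.continuous_fderiv one_ne_zero
  have huc : Continuous (u t) := hu1.continuous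
  have hDuc : Continuous (fderiv ℝ (u t)) := hu1.continuous_fderiv one_ne_zero
  -- the force slice is smooth (a classical solution's force is jointly smooth)
  have hf1 : ContDiff ℝ 1 (f t) :=
    ((hsol.isSmoothSpaceTimeOn_force hU).contDiff_slice ht).of_le (by norm_cast)
  have hcfc : Continuous (curl (f t)) := continuous_curl hf1
  -- the weight
  have hχs : ContDiff ℝ 1 χ := contDiff_sqBallCutoff R
  have hχc : HasCompactSupport χ := hasCompactSupport_sqBallCutoff hR0
  obtain ⟨K, hK⟩ : ∃ K, LipschitzWith K χ := exists_lipschitzWith_sqBallCutoff hR0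
  have hχd : ∀ x, DifferentiableAt ℝ χ x := fun x => (hχs.differentiable one_ne_zero) x
  have hχcont : Continuous χ := hχs.continuous
  have hDχc : HasCompactSupport (fderiv ℝ χ) := hχc.fderiv ℝ
  have hDχcont : Continuous (fderiv ℝ χ) := hχs.continuous_fderiv one_ne_zero
  have hDχ : ∀ x, ‖fderiv ℝ χ x‖ ≤ 4 * Real.sqrt 2 * D / R := fun x =>
    norm_fderiv_sqBallCutoff_le' hD hR0 x
  have hχ01 : ∀ x, 0 ≤ χ x ∧ χ x ≤ 1 := fun x => ⟨sqBallCutoff_nonneg R x, sqBallCutoff_le_one R x⟩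
  -- the identity (10.11), WITH the force term
  have hid := integral_enstrophyProduction_mul_weight hT hsol ht hK hχc
  have hld : ∀ x v, lineDeriv ℝ χ x v = fderiv ℝ χ x v := fun x v =>
    (hχd x).lineDeriv_eq_fderiv
  simp_rw [hld] at hid
  rw [hid]
  -- (i) the viscous cross term is `O(1/R)`
  have hcross : ∀ j : Fin 3, |∫ x, ⟪curl (u t) x, fderiv ℝ (curl (u t)) x
      (EuclideanSpace.single j (1 : ℝ))⟫ * fderiv ℝ χ x (EuclideanSpace.single j (1 : ℝ))| ≤
      2 * Real.sqrt 2 * D / R * (Ystar + Dstar) := by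
    intro j
    have hsingle : ‖(EuclideanSpace.single j (1 : ℝ) : EuclideanSpace ℝ (Fin 3))‖ = 1 := by
      rw [PiLp.norm_single, norm_one]
    have hpt : ∀ x, |⟪curl (u t) x, fderiv ℝ (curl (u t)) x (EuclideanSpace.single j (1 : ℝ))⟫ *
        fderiv ℝ χ x (EuclideanSpace.single j (1 : ℝ))| ≤
        2 * Real.sqrt 2 * D / R *
          (‖curl (u t) x‖ ^ 2 + frobeniusNormSq (fderiv ℝ (curl (u t)) x)) := by
      intro x
      rw [abs_mul]
      have h1 : |⟪curl (u t) x, fderiv ℝ (curl (u t)) x (EuclideanSpace.single j (1 : ℝ))⟫| ≤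
          ‖curl (u t) x‖ * ‖fderiv ℝ (curl (u t)) x‖ := by
        refine (abs_real_inner_le_norm _ _).trans (mul_le_mul_of_nonneg_left ?_ (norm_nonneg _))
        calc _ ≤ ‖fderiv ℝ (curl (u t)) x‖ * ‖(EuclideanSpace.single j (1 : ℝ) :
            EuclideanSpace ℝ (Fin 3))‖ := ContinuousLinearMap.le_opNorm _ _
          _ = _ := by rw [hsingle, mul_one]
      have h2 : |fderiv ℝ χ x (EuclideanSpace.single j (1 : ℝ))| ≤ 4 * Real.sqrt 2 * D / R := by
        rw [← Real.norm_eq_abs]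
        calc _ ≤ ‖fderiv ℝ χ x‖ * ‖(EuclideanSpace.single j (1 : ℝ) : EuclideanSpace ℝ (Fin 3))‖ :=
            ContinuousLinearMap.le_opNorm _ _
          _ ≤ 4 * Real.sqrt 2 * D / R := by rw [hsingle, mul_one]; exact hDχ x
      have h3 : ‖fderiv ℝ (curl (u t)) x‖ ^ 2 ≤ frobeniusNormSq (fderiv ℝ (curl (u t)) x) :=
        sq_opNorm_le_frobeniusNormSq _
      have h4 : ‖curl (u t) x‖ * ‖fderiv ℝ (curl (u t)) x‖ ≤
          (‖curl (u t) x‖ ^ 2 + frobeniusNormSq (fderiv ℝ (curl (u t)) x)) / 2 := by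
        nlinarith [sq_nonneg (‖curl (u t) x‖ - ‖fderiv ℝ (curl (u t)) x‖)]
      calc _ ≤ (‖curl (u t) x‖ * ‖fderiv ℝ (curl (u t)) x‖) * (4 * Real.sqrt 2 * D / R) :=
            mul_le_mul h1 h2 (abs_nonneg _) (by positivity)
        _ ≤ (‖curl (u t) x‖ ^ 2 + frobeniusNormSq (fderiv ℝ (curl (u t)) x)) / 2 *
            (4 * Real.sqrt 2 * D / R) := by gcongr
        _ = _ := by ring
    have hI : Integrable fun x => ⟪curl (u t) x, fderiv ℝ (curl (u t)) x
        (EuclideanSpace.single j (1 : ℝ))⟫ * fderiv ℝ χ x (EuclideanSpace.single j (1 : ℝ)) :=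
      integrable_mul_of_continuous_of_hasCompactSupport
        (hωc.inner (hDωc.clm_apply continuous_const)) (hDχcont.clm_apply continuous_const)
        (hDχc.mono fun x hx => by
          simp only [mem_support, ne_eq] at hx ⊢
          intro h; exact hx (by rw [h]; rfl))
    calc _ ≤ ∫ x, |⟪curl (u t) x, fderiv ℝ (curl (u t)) x (EuclideanSpace.single j (1 : ℝ))⟫ *
          fderiv ℝ χ x (EuclideanSpace.single j (1 : ℝ))| := abs_integral_le_integral_abs
      _ ≤ ∫ x, 2 * Real.sqrt 2 * D / R *
          (‖curl (u t) x‖ ^ 2 + frobeniusNormSq (fderiv ℝ (curl (u t)) x)) :=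
          integral_mono hI.abs ((hY.add hDi).const_mul _) hpt
      _ = 2 * Real.sqrt 2 * D / R * ((∫ x, ‖curl (u t) x‖ ^ 2) +
          ∫ x, frobeniusNormSq (fderiv ℝ (curl (u t)) x)) := by
          rw [MeasureTheory.integral_const_mul, integral_add hY hDi]
      _ ≤ 2 * Real.sqrt 2 * D / R * (Ystar + Dstar) := by gcongr
  have hcross' : -(ν * ∑ j : Fin 3, ∫ x, ⟪curl (u t) x, fderiv ℝ (curl (u t)) x
      (EuclideanSpace.single j (1 : ℝ))⟫ * fderiv ℝ χ x (EuclideanSpace.single j (1 : ℝ))) ≤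
      ν * (6 * Real.sqrt 2 * D / R * (Ystar + Dstar)) := by
    have hsum : |∑ j : Fin 3, ∫ x, ⟪curl (u t) x, fderiv ℝ (curl (u t)) x
        (EuclideanSpace.single j (1 : ℝ))⟫ * fderiv ℝ χ x (EuclideanSpace.single j (1 : ℝ))| ≤
        6 * Real.sqrt 2 * D / R * (Ystar + Dstar) := by
      refine (Finset.abs_sum_le_sum_abs _ _).trans ?_
      calc _ ≤ ∑ j : Fin 3, 2 * Real.sqrt 2 * D / R * (Ystar + Dstar) :=
            Finset.sum_le_sum fun j _ => hcross j
        _ = _ := by rw [Fin.sum_univ_three]; ring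
    have := neg_abs_le (∑ j : Fin 3, ∫ x, ⟪curl (u t) x, fderiv ℝ (curl (u t)) x
        (EuclideanSpace.single j (1 : ℝ))⟫ * fderiv ℝ χ x (EuclideanSpace.single j (1 : ℝ)))
    nlinarith [mul_le_mul_of_nonneg_left hsum hν]
  -- (ii) the transport term is `O(1/R)`
  have htrans : |∫ x, ‖curl (u t) x‖ ^ 2 * fderiv ℝ χ x (u t x)| ≤
      4 * Real.sqrt 2 * D / R * V * Ystar := by
    have hpt : ∀ x, |‖curl (u t) x‖ ^ 2 * fderiv ℝ χ x (u t x)| ≤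
        4 * Real.sqrt 2 * D / R * V * ‖curl (u t) x‖ ^ 2 := by
      intro x
      rw [abs_mul, abs_of_nonneg (sq_nonneg _)]
      have h1 : |fderiv ℝ χ x (u t x)| ≤ 4 * Real.sqrt 2 * D / R * V := by
        rw [← Real.norm_eq_abs]
        calc _ ≤ ‖fderiv ℝ χ x‖ * ‖u t x‖ := ContinuousLinearMap.le_opNorm _ _
          _ ≤ 4 * Real.sqrt 2 * D / R * V :=
            mul_le_mul (hDχ x) (hV x) (norm_nonneg _) (by positivity)
      calc _ ≤ ‖curl (u t) x‖ ^ 2 * (4 * Real.sqrt 2 * D / R * V) :=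
          mul_le_mul_of_nonneg_left h1 (sq_nonneg _)
        _ = _ := by ring
    have hI : Integrable fun x => ‖curl (u t) x‖ ^ 2 * fderiv ℝ χ x (u t x) :=
      integrable_mul_of_continuous_of_hasCompactSupport (hωc.norm.pow 2) (hDχcont.clm_apply huc)
        (hDχc.mono fun x hx => by
          simp only [mem_support, ne_eq] at hx ⊢
          intro h; exact hx (by rw [h]; rfl))
    calc _ ≤ ∫ x, |‖curl (u t) x‖ ^ 2 * fderiv ℝ χ x (u t x)| := abs_integral_le_integral_abs
      _ ≤ ∫ x, 4 * Real.sqrt 2 * D / R * V * ‖curl (u t) x‖ ^ 2 :=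
          integral_mono hI.abs (hY.const_mul _) hpt
      _ = 4 * Real.sqrt 2 * D / R * V * ∫ x, ‖curl (u t) x‖ ^ 2 :=
          MeasureTheory.integral_const_mul _ _
      _ ≤ 4 * Real.sqrt 2 * D / R * V * Ystar := by gcongr
  have htrans' : 1 / 2 * (∫ x, ‖curl (u t) x‖ ^ 2 * fderiv ℝ χ x (u t x)) ≤
      2 * Real.sqrt 2 * D / R * V * Ystar := by
    have h1 := (le_abs_self (∫ x, ‖curl (u t) x‖ ^ 2 * fderiv ℝ χ x (u t x))).trans htrans
    have h2 : (1 : ℝ) / 2 * (4 * Real.sqrt 2 * D / R * V * Ystar) =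
        2 * Real.sqrt 2 * D / R * V * Ystar := by ring
    rw [← h2]
    exact mul_le_mul_of_nonneg_left h1 (by norm_num)
  -- (iii) the stretching term
  have hstretch : (∫ x, ⟪curl (u t) x, convect (curl (u t)) (u t) x⟫ * χ x) ≤
      ∫ x, |q x| * ‖curl (u t) x‖ * ‖u t x‖ := by
    have hpt : ∀ x, ⟪curl (u t) x, convect (curl (u t)) (u t) x⟫ * χ x ≤
        |q x| * ‖curl (u t) x‖ * ‖u t x‖ := by
      intro x
      rw [convect_apply]
      have hωx : curl (u t) x = q x • rotGen x := by rw [hω]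
      have h1 := abs_inner_stretch_le_of_eq_smul_rotGen hωx (hax' x)
      have h2 := le_abs_self ⟪curl (u t) x, fderiv ℝ (u t) x (curl (u t) x)⟫
      have h3 : 0 ≤ |q x| * ‖curl (u t) x‖ * ‖u t x‖ := by positivity
      calc _ ≤ |⟪curl (u t) x, fderiv ℝ (u t) x (curl (u t) x)⟫| * χ x :=
            mul_le_mul_of_nonneg_right h2 (hχ01 x).1
        _ ≤ |q x| * ‖curl (u t) x‖ * ‖u t x‖ * 1 :=
            mul_le_mul h1 (hχ01 x).2 (hχ01 x).1 h3
        _ = _ := mul_one _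
    have hI : Integrable fun x => ⟪curl (u t) x, convect (curl (u t)) (u t) x⟫ * χ x :=
      integrable_mul_of_continuous_of_hasCompactSupport
        (hωc.inner (hDuc.clm_apply hωc)) hχcont hχc
    exact integral_mono hI hSi hpt
  -- (iv) the work of the force's vorticity
  have hwork : (∫ x, ⟪curl (u t) x, curl (f t) x⟫ * χ x) ≤
      ∫ x, ‖curl (u t) x‖ * ‖curl (f t) x‖ := by
    have hpt : ∀ x, ⟪curl (u t) x, curl (f t) x⟫ * χ x ≤ ‖curl (u t) x‖ * ‖curl (f t) x‖ := by
      intro x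
      have h1 := (le_abs_self ⟪curl (u t) x, curl (f t) x⟫).trans (abs_real_inner_le_norm _ _)
      have h3 : 0 ≤ ‖curl (u t) x‖ * ‖curl (f t) x‖ := by positivity
      calc _ ≤ ‖curl (u t) x‖ * ‖curl (f t) x‖ * χ x :=
            mul_le_mul_of_nonneg_right h1 (hχ01 x).1
        _ ≤ ‖curl (u t) x‖ * ‖curl (f t) x‖ * 1 :=
            mul_le_mul_of_nonneg_left (hχ01 x).2 h3
        _ = _ := mul_one _
    have hI : Integrable fun x => ⟪curl (u t) x, curl (f t) x⟫ * χ x :=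
      integrable_mul_of_continuous_of_hasCompactSupport (hωc.inner hcfc) hχcont hχc
    exact integral_mono hI hWi hpt
  -- collect
  have hRle :
      ν * (6 * Real.sqrt 2 * D / R * (Ystar + Dstar)) + 2 * Real.sqrt 2 * D / R * V * Ystar =
      (6 * Real.sqrt 2 * ν * D * (Ystar + Dstar) + 2 * Real.sqrt 2 * D * V * Ystar) / R := by
    field_simp
  linarith [hcross', htrans', hstretch, hwork, hRle, hΦ]

end Slice

/-! ### Time integration against the ball cutoff -/

section Integrated

variable {T ν : ℝ} {f u : ℝ → EuclideanSpace ℝ (Fin 3) → EuclideanSpace ℝ (Fin 3)}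
  {p : ℝ → EuclideanSpace ℝ (Fin 3) → ℝ}

/-- **The forced enstrophy inequality against the ball cutoff, integrated in time**: under uniform
(in `t ∈ [0, T]`) versions of the hypotheses of `enstrophyProduction_sqBallCutoff_le_forced` and
with a majorant `Φ ∈ L¹(0, T)` of the stretching-plus-work integrals
`∫ |q| |ω| |u| + ∫ |ω| |curl f|`,
`½∫|ω(t)|²χ_R − ½∫|ω(0)|²χ_R + ν∫₀ᵗ∫|Dω|²_Fχ_R ≤ C t/R + ∫₀ᵗ Φ`,
`C = 6√2νD(Y⋆ + D⋆) + 2√2DVY⋆`. [cite: LemarieRieusset2016, §10.3 p. 289] -/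
theorem enstrophy_sqBallCutoff_integral_le_forced (hT : 0 < T) (hν : 0 ≤ ν)
    (hsol : IsClassicalNSSolutionOn (Icc 0 T) ν f u p)
    (hax : ∀ s ∈ Icc 0 T, IsAxisymmetric (u s)) (hsw : ∀ s ∈ Icc 0 T, HasNoSwirl (u s))
    {D : ℝ} (hD : ∀ s, |deriv Real.smoothTransition s| ≤ D) {R : ℝ} (hR : 1 ≤ R)
    {V Ystar Dstar : ℝ} (hV : ∀ s ∈ Icc 0 T, ∀ x, ‖u s x‖ ≤ V)
    (hY : ∀ s ∈ Icc 0 T, Integrable fun x => ‖curl (u s) x‖ ^ 2)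
    (hYstar : ∀ s ∈ Icc 0 T, ∫ x, ‖curl (u s) x‖ ^ 2 ≤ Ystar)
    (hDi : ∀ s ∈ Icc 0 T, Integrable fun x => frobeniusNormSq (fderiv ℝ (curl (u s)) x))
    (hDstar : ∀ s ∈ Icc 0 T, ∫ x, frobeniusNormSq (fderiv ℝ (curl (u s)) x) ≤ Dstar)
    (hSi : ∀ s ∈ Icc 0 T, Integrable fun x =>
      |hadamardQuotFst (fun y => curl (u s) y 1) x| * ‖curl (u s) x‖ * ‖u s x‖)
    (hWi : ∀ s ∈ Icc 0 T, Integrable fun x => ‖curl (u s) x‖ * ‖curl (f s) x‖)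
    {Φ : ℝ → ℝ} (hΦi : IntegrableOn Φ (Icc 0 T))
    (hΦ : ∀ s ∈ Icc 0 T,
      (∫ x, |hadamardQuotFst (fun y => curl (u s) y 1) x| * ‖curl (u s) x‖ * ‖u s x‖) +
        (∫ x, ‖curl (u s) x‖ * ‖curl (f s) x‖) ≤ Φ s)
    {t : ℝ} (ht : t ∈ Icc 0 T) :
    1 / 2 * (∫ x, ‖curl (u t) x‖ ^ 2 * Real.smoothTransition (2 - ‖x‖ ^ 2 / R ^ 2) ^ 2)
      - 1 / 2 * (∫ x, ‖curl (u 0) x‖ ^ 2 * Real.smoothTransition (2 - ‖x‖ ^ 2 / R ^ 2) ^ 2)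
      + ν * ∫ s in (0 : ℝ)..t, ∫ x, frobeniusNormSq (fderiv ℝ (curl (u s)) x) *
          Real.smoothTransition (2 - ‖x‖ ^ 2 / R ^ 2) ^ 2 ≤
      (6 * Real.sqrt 2 * ν * D * (Ystar + Dstar) + 2 * Real.sqrt 2 * D * V * Ystar) / R * t +
        ∫ s in (0 : ℝ)..t, Φ s := by
  set χ : EuclideanSpace ℝ (Fin 3) → ℝ := fun y =>
    Real.smoothTransition (2 - ‖y‖ ^ 2 / R ^ 2) ^ 2 with hχdef
  set C : ℝ := (6 * Real.sqrt 2 * ν * D * (Ystar + Dstar) + 2 * Real.sqrt 2 * D * V * Ystar) / R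
    with hCdef
  have hR0 : 0 < R := by linarith
  have hχcont : Continuous χ := (contDiff_sqBallCutoff R (n := 0)).continuous
  have hχc : HasCompactSupport χ := hasCompactSupport_sqBallCutoff hR0
  have htT : Icc 0 t ⊆ Icc 0 T := Icc_subset_Icc le_rfl ht.2
  -- the fundamental theorem of calculus for the localised enstrophy
  have hftc := localisedEnstrophy_sub_eq_integral hT hsol.smooth_velocity hχcont hχc ht
  rw [localisedEnstrophy_def, localisedEnstrophy_def] at hftc
  -- continuity in time of production and weighted dissipation
  have hPc := continuousOn_integral_enstrophyProduction_static hT hsol.smooth_velocity hχcont hχc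
  have hDc := continuousOn_localisedEnstrophyDissipation_static hT hsol.smooth_velocity hχcont hχc
  simp only [localisedEnstrophyDissipation_def] at hDc
  have hPint : IntervalIntegrable (fun s => ∫ x, enstrophyProduction T u s x * χ x) volume 0 t :=
    (hPc.mono htT).intervalIntegrable_of_Icc ht.1
  have hDint : IntervalIntegrable
      (fun s => ∫ x, frobeniusNormSq (fderiv ℝ (curl (u s)) x) * χ x) volume 0 t :=
    (hDc.mono htT).intervalIntegrable_of_Icc ht.1
  have hΦint : IntervalIntegrable Φ volume 0 t :=
    (intervalIntegrable_iff_integrableOn_Icc_of_le ht.1).2 (hΦi.mono_set htT)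
  -- the slice inequality at every time of `[0, t]`
  have hslice : ∀ s ∈ Icc 0 t, ∫ x, enstrophyProduction T u s x * χ x ≤
      -(ν * ∫ x, frobeniusNormSq (fderiv ℝ (curl (u s)) x) * χ x) + C + Φ s := by
    intro s hs
    have hs' : s ∈ Icc 0 T := htT hs
    exact enstrophyProduction_sqBallCutoff_le_forced hT hν hsol hs' (hax s hs') (hsw s hs') hD hR
      (hV s hs') (hY s hs') (hYstar s hs') (hDi s hs') (hDstar s hs') (hSi s hs') (hWi s hs')
      (hΦ s hs')
  have i1 : IntervalIntegrable
      (fun s => -(ν * ∫ x, frobeniusNormSq (fderiv ℝ (curl (u s)) x) * χ x)) volume 0 t :=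
    (hDint.const_mul ν).neg
  have i12 : IntervalIntegrable
      (fun s => -(ν * ∫ x, frobeniusNormSq (fderiv ℝ (curl (u s)) x) * χ x) + C) volume 0 t :=
    i1.add intervalIntegrable_const
  have hmono := intervalIntegral.integral_mono_on ht.1 hPint (i12.add hΦint) hslice
  have hsplit : ∫ s in (0 : ℝ)..t, (-(ν * ∫ x, frobeniusNormSq (fderiv ℝ (curl (u s)) x) * χ x)
      + C + Φ s) = -(ν * ∫ s in (0 : ℝ)..t, ∫ x, frobeniusNormSq (fderiv ℝ (curl (u s)) x) * χ x)
      + C * t + ∫ s in (0 : ℝ)..t, Φ s := by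
    rw [intervalIntegral.integral_add i12 hΦint,
      intervalIntegral.integral_add i1 intervalIntegrable_const, intervalIntegral.integral_neg,
      intervalIntegral.integral_const_mul, intervalIntegral.integral_const]
    simp
    ring
  rw [hsplit] at hmono
  linarith [hmono, hftc]

end Integrated

/-! ### The forced enstrophy inequality on the whole space -/

section Whole

variable {T ν : ℝ} {f u : ℝ → EuclideanSpace ℝ (Fin 3) → EuclideanSpace ℝ (Fin 3)}
  {p : ℝ → EuclideanSpace ℝ (Fin 3) → ℝ}

/-- **The enstrophy inequality for axisymmetric flows without swirl, WITH A FORCE**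
(Lemarié-Rieusset 2016, p. 289, integrated form, with the stretching term and the work of the
force kept as a majorant: `∂ₜ‖ω‖₂² = −2ν‖∇⊗ω‖₂² + 2∫ u_r ω_θ²/r dx + 2∫⟨ω, curl f⟩`,
`|u_r ω_θ²/r| ≤ |u| |ω_θ/r| |ω_θ|`, `|⟨ω, curl f⟩| ≤ |ω| |curl f|`). For a classical solution
of the Navier–Stokes system with force `f` on `[0, T] × ℝ³`, axisymmetric without swirl at all
times, with `|u| ≤ V`, `ω(t), ∇ω(t) ∈ L²` uniformly, and a majorant `Φ ∈ L¹(0,T)` with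
`∫ |q(s)| |ω(s)| |u(s)| dx + ∫ |ω(s)| |curl f(s)| dx ≤ Φ(s)` (`q = ω_θ/r`):
`‖ω(t)‖₂² + 2ν ∫₀ᵗ ‖∇ω‖²_{L²} ≤ ‖ω(0)‖₂² + 2∫₀ᵗ Φ` for `t ∈ [0, T]`
(`|∇ω|²` the squared Frobenius norm). Proof: `enstrophy_sqBallCutoff_integral_le_forced` and
`R → ∞` by dominated convergence in space and in time, verbatim as in the unforced
`enstrophy_integral_le`. [cite: LemarieRieusset2016, §10.3 p. 289] -/
theorem enstrophy_integral_le_forced (hT : 0 < T) (hν : 0 ≤ ν)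
    (hsol : IsClassicalNSSolutionOn (Icc 0 T) ν f u p)
    (hax : ∀ s ∈ Icc 0 T, IsAxisymmetric (u s)) (hsw : ∀ s ∈ Icc 0 T, HasNoSwirl (u s))
    {V Ystar Dstar : ℝ} (hV : ∀ s ∈ Icc 0 T, ∀ x, ‖u s x‖ ≤ V)
    (hY : ∀ s ∈ Icc 0 T, Integrable fun x => ‖curl (u s) x‖ ^ 2)
    (hYstar : ∀ s ∈ Icc 0 T, ∫ x, ‖curl (u s) x‖ ^ 2 ≤ Ystar)
    (hDi : ∀ s ∈ Icc 0 T, Integrable fun x => frobeniusNormSq (fderiv ℝ (curl (u s)) x))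
    (hDstar : ∀ s ∈ Icc 0 T, ∫ x, frobeniusNormSq (fderiv ℝ (curl (u s)) x) ≤ Dstar)
    (hSi : ∀ s ∈ Icc 0 T, Integrable fun x =>
      |hadamardQuotFst (fun y => curl (u s) y 1) x| * ‖curl (u s) x‖ * ‖u s x‖)
    (hWi : ∀ s ∈ Icc 0 T, Integrable fun x => ‖curl (u s) x‖ * ‖curl (f s) x‖)
    {Φ : ℝ → ℝ} (hΦi : IntegrableOn Φ (Icc 0 T))
    (hΦ : ∀ s ∈ Icc 0 T,
      (∫ x, |hadamardQuotFst (fun y => curl (u s) y 1) x| * ‖curl (u s) x‖ * ‖u s x‖) +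
        (∫ x, ‖curl (u s) x‖ * ‖curl (f s) x‖) ≤ Φ s)
    {t : ℝ} (ht : t ∈ Icc 0 T) :
    (∫ x, ‖curl (u t) x‖ ^ 2) +
        2 * ν * ∫ s in (0 : ℝ)..t, ∫ x, frobeniusNormSq (fderiv ℝ (curl (u s)) x) ≤
      (∫ x, ‖curl (u 0) x‖ ^ 2) + 2 * ∫ s in (0 : ℝ)..t, Φ s := by
  obtain ⟨D, hD0, hD⟩ := Calculus.exists_bound_deriv_smoothTransition
  set C : ℝ := 6 * Real.sqrt 2 * ν * D * (Ystar + Dstar) + 2 * Real.sqrt 2 * D * V * Ystar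
    with hCdef
  have h0T : (0 : ℝ) ∈ Icc 0 T := ⟨le_rfl, hT.le⟩
  have htT : Icc 0 t ⊆ Icc 0 T := Icc_subset_Icc le_rfl ht.2
  -- the cutoff inequality for `R = m + 1`
  have hm : ∀ m : ℕ,
      1 / 2 * (∫ x, ‖curl (u t) x‖ ^ 2 *
          Real.smoothTransition (2 - ‖x‖ ^ 2 / ((m : ℝ) + 1) ^ 2) ^ 2)
      - 1 / 2 * (∫ x, ‖curl (u 0) x‖ ^ 2 *
          Real.smoothTransition (2 - ‖x‖ ^ 2 / ((m : ℝ) + 1) ^ 2) ^ 2)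
      + ν * ∫ s in (0 : ℝ)..t, ∫ x, frobeniusNormSq (fderiv ℝ (curl (u s)) x) *
          Real.smoothTransition (2 - ‖x‖ ^ 2 / ((m : ℝ) + 1) ^ 2) ^ 2 ≤
      C / ((m : ℝ) + 1) * t + ∫ s in (0 : ℝ)..t, Φ s := by
    intro m
    have hR1 : (1 : ℝ) ≤ (m : ℝ) + 1 := by
      have : (0 : ℝ) ≤ m := Nat.cast_nonneg m
      linarith
    exact enstrophy_sqBallCutoff_integral_le_forced hT hν hsol hax hsw hD hR1 hV hY hYstar hDi
      hDstar hSi hWi hΦi hΦ ht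
  -- limits of the three cutoff quantities
  have hl1 := tendsto_integral_mul_sqBallCutoff (hY t ht)
  have hl2 := tendsto_integral_mul_sqBallCutoff (hY 0 h0T)
  have hl3 : Tendsto (fun m : ℕ => ∫ s in (0 : ℝ)..t, ∫ x,
      frobeniusNormSq (fderiv ℝ (curl (u s)) x) *
        Real.smoothTransition (2 - ‖x‖ ^ 2 / ((m : ℝ) + 1) ^ 2) ^ 2) atTop
      (𝓝 (∫ s in (0 : ℝ)..t, ∫ x, frobeniusNormSq (fderiv ℝ (curl (u s)) x))) := by
    refine intervalIntegral.tendsto_integral_filter_of_dominated_convergence (fun _ => Dstar)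
      (Eventually.of_forall fun m => ?_) (Eventually.of_forall fun m => ae_of_all _ fun s hs => ?_)
      intervalIntegrable_const (ae_of_all _ fun s hs => ?_)
    · have hR0 : (0 : ℝ) < (m : ℝ) + 1 := by positivity
      have h := continuousOn_localisedEnstrophyDissipation_static hT hsol.smooth_velocity
        (contDiff_sqBallCutoff ((m : ℝ) + 1) (n := 0)).continuous
        (hasCompactSupport_sqBallCutoff hR0)
      simp only [localisedEnstrophyDissipation_def] at h
      have hsub : Ι 0 t ⊆ Icc 0 T := by
        rw [uIoc_of_le ht.1]; exact Ioc_subset_Icc_self.trans htT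
      exact (h.mono hsub).aestronglyMeasurable measurableSet_uIoc
    · have hs' : s ∈ Icc 0 T := by
        rw [uIoc_of_le ht.1] at hs; exact htT (Ioc_subset_Icc_self hs)
      have hw01 : ∀ x : EuclideanSpace ℝ (Fin 3),
          0 ≤ Real.smoothTransition (2 - ‖x‖ ^ 2 / ((m : ℝ) + 1) ^ 2) ^ 2 ∧
            Real.smoothTransition (2 - ‖x‖ ^ 2 / ((m : ℝ) + 1) ^ 2) ^ 2 ≤ 1 := fun x =>
        ⟨sqBallCutoff_nonneg _ x, sqBallCutoff_le_one _ x⟩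
      have hint : Integrable fun x => frobeniusNormSq (fderiv ℝ (curl (u s)) x) *
          Real.smoothTransition (2 - ‖x‖ ^ 2 / ((m : ℝ) + 1) ^ 2) ^ 2 :=
        (hDi s hs').mul_bdd (contDiff_sqBallCutoff _ (n := 0)).continuous.aestronglyMeasurable
          (ae_of_all _ fun x => by
            rw [Real.norm_eq_abs, abs_of_nonneg (hw01 x).1]; exact (hw01 x).2)
      have hnn : 0 ≤ ∫ x, frobeniusNormSq (fderiv ℝ (curl (u s)) x) *
          Real.smoothTransition (2 - ‖x‖ ^ 2 / ((m : ℝ) + 1) ^ 2) ^ 2 :=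
        integral_nonneg fun x => mul_nonneg (frobeniusNormSq_nonneg _) (hw01 x).1
      have hle : ∫ x, frobeniusNormSq (fderiv ℝ (curl (u s)) x) *
          Real.smoothTransition (2 - ‖x‖ ^ 2 / ((m : ℝ) + 1) ^ 2) ^ 2 ≤ Dstar := by
        refine (integral_mono hint (hDi s hs') fun x => ?_).trans (hDstar s hs')
        have h0 := frobeniusNormSq_nonneg (fderiv ℝ (curl (u s)) x)
        have := (hw01 x).2
        nlinarith
      rw [Real.norm_eq_abs, abs_of_nonneg hnn]
      exact hle
    · have hs' : s ∈ Icc 0 T := by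
        rw [uIoc_of_le ht.1] at hs; exact htT (Ioc_subset_Icc_self hs)
      exact tendsto_integral_mul_sqBallCutoff (hDi s hs')
  have hl4 : Tendsto (fun m : ℕ => C / ((m : ℝ) + 1) * t + ∫ s in (0 : ℝ)..t, Φ s) atTop
      (𝓝 (C * 0 * t + ∫ s in (0 : ℝ)..t, Φ s)) := by
    have h0 : Tendsto (fun m : ℕ => (1 : ℝ) / ((m : ℝ) + 1)) atTop (𝓝 0) :=
      tendsto_one_div_add_atTop_nhds_zero_nat
    have h1 : Tendsto (fun m : ℕ => C / ((m : ℝ) + 1)) atTop (𝓝 (C * 0)) := by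
      refine ((tendsto_const_nhds (x := C)).mul h0).congr fun m => ?_
      ring
    exact (h1.mul tendsto_const_nhds).add tendsto_const_nhds
  have hlhs := ((hl1.const_mul (1 / 2 : ℝ)).sub (hl2.const_mul (1 / 2 : ℝ))).add (hl3.const_mul ν)
  have := le_of_tendsto_of_tendsto' hlhs hl4 hm
  simp only [mul_zero, zero_mul, zero_add] at this
  linarith

end Whole

end Literature.Analysis.FluidPDE

end
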